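import Summits.QuantumFields.BalabanUV.Beta.FP.NestedDressingLinear

/-!
# `BalabanUV.Beta.FP.NestedDressingLegs` — road «FP» for binder row D1, W-ORACLE-K row **SLOT** (owner d1-p3 gen 15, memo `N2B-DESIGN.md` v3.1 §11 (11a):
# «`TP (m+1) = hessKer G_N V′ W′`-shape — move the outer dressing from the jets to the resolvent and the column dressing into `vertexOfK`; the m = 1 twin is how the
# root reads `TbalOf (JsB12Sym …)` through `Gsym`»), PART 1 of 2: THE NESTED DRESSING's LEG CALCULUS — decl-by-decl twins of an2's `SymmetrisedDressingLegs` §1–§2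
# and `SymmetrisedDressingLinear` §5 with `piKSymBm ρ N ↦ piKSymNest ρ Lc M` (FILE 4),
# window `cube N ↦ cube (Lc^M)`, bound `1 + 4(d+1)N ↦ 1 + 4(d+1)(M·Lc^M)`; the multiplier-leg BLOCKING `N` of `colH`∕`vertexOfK` is kept as a separate parameter

HONEST DEPENDENCY (page 1, mandatory): continuum YM on T⁴ ⇐ BetaPertH ∧ nine spine estimates (0/9 proved); BetaPertH ⇐ (D1) ∧ (D4) ∧ CAP+tail;
G-an2-4 gates asym, D1 and NE2/3/4.  HONEST FRAMING (cell contract, verbatim): «discharging `BetaPertH` makes Bałaban's UV stability UNCONDITIONAL —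
a real constructive-QFT result; it is NOT the continuum limit and NOT the Clay problem.»  THIS MODULE DISCHARGES NOTHING of the wall: [folklore] finite window sums,
fibre contractions and Fubini over finite windows; plumbing definitions `dressKNestAt`, `coDressKNestAt` (the comp-form dressings, an2's `dressKSymAt`∕`coDressKSymAt` one
level up; leaf-02's inline `G_nest` by `rfl`), `cWnest`, `coProjNestAtT` (the `Π̂ᵀ`-side window action; FILE 7's `coProjNestAt` is the `Π̂`-side one = an2's `coProjSymW`),
`legCo₁NestAt`, `legCo₂NestAt` — [our objects, plumbing], no `def … : Prop`, nothing cited, 0 sorry; 0∕4 row-D1 binders; NOT SLOT itself (PART 2 `FP/NestedDressingSlot`: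
the functor `dressNestAt`, the vertex transfer and `hessKer_dressNestAt`), NOT (SDF), NOT D1, NOT `BetaPertH`, NOT continuum, NOT Clay.  «not in print; our bookkeeping».

ABSOLUTE RULE (cell charter, verbatim): «No internally-minted statement may enter as a cited fact. Every hypothesis is either kernel-proved in
this package or a verbatim quotation of a PUBLISHED theorem with page reference. The manuscript(s) under audit are NOT citable for their own
disputed steps — they are the thing under adjudication; programme-internal (2001/route/tribunal) claims are never citable.»

CONTENT (generic `d`; window `cube (d+1) (Lc^M)`, in-block root `r ∈ box (d+1) Lc` and `1 ≤ Lc` where stated; an2's proofs VERBATIM under the substitution):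
§0 `dressKNestAt` ∕ `coDressKNestAt` (+ `_eq`); §1 `abs_pmSymNest_le'`, `coProjNestAtT` (+ `_apply`), `abs_coProjNestAtT_le`, `coProjNestAtT_shift`; §2 `legCo₁NestAt` ∕ `legCo₂NestAt`
(+ computation rules), the four fibre contractions `sum_piKSymNest_mul_inl ∕ _inr`, `sum_mul_piKSymNest_inl ∕ _inr`, `legCo₁NestAt_eq_comp`, `legCo₂NestAt_eq_comp`,
`dressKNestAt_eq_legs`; §3 `coProjNestAtT_tsum`, `summable_family_*`, `legCo₁∕₂NestAt_tsum`, `dressKNestAt_tsum ∕ _mul_left ∕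
_finset_sum ∕ _wsum`, **`vertexOfK_dressKNestAt`**.
Provenance: road FP swarm LEAF PROVER `b2b-balaban-beta-d1-formalise-leaf-06` gen 15, 2026-08-21, row SLOT (first refusal leaf-06 ∕ an2, owner l.34473); the mathematics is
an2's (β sub-cell, `SymmetrisedDressing*`, gen 26), ported by script.  Names PROVISIONAL.
-/

open Finset
open scoped BigOperators
open Literature.MathematicalPhysics.QuantumFieldTheory
open Literature.MathematicalPhysics.QuantumFieldTheory.Balaban1983to89
open Literature.MathematicalPhysics.QuantumFieldTheory.Balaban1983to89.Beta
open B12Sec2to5 (l1 l1_nonneg)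
open ExpKernelCalculus (MKer Decays BiLoc comp tr shiftK l1_sub_triangle l1_sub_symm)
open AffineAveraging (Form0 Form1 box toSite unitVec unitVec_apply)
open OneStepResolventKernel (Fib LocStencil JetData wsum)
open OneStepKernelFamily (colH vertexOfK)
open Summit.QuantumFields.BalabanUV.Beta.TameKernelCalculus
open Summit.QuantumFields.BalabanUV.Beta.AxialDressingRooted
open Summit.QuantumFields.BalabanUV.Beta.SymmetrisedDressingMatrix (bondIndR)
open Summit.QuantumFields.BalabanUV.Beta.FP.NestedDressingKernel (pmSymNest piKSymNest piKSymNest_inl_inl piKSymNest_inl_inr piKSymNest_inr_inl piKSymNest_inr_inr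
  abs_pmSymNest_le pmSymNest_shift)

namespace Summit.QuantumFields.BalabanUV.Beta.FP.NestedDressingLegs

noncomputable section

variable {d : ℕ}

/-- [our object, plumbing] THE WINDOW CONSTANT of the nested projector's `Π̂ᵀ`-side action: `(2·Lc^M + 1)^{d+1} · (d+1) · (1 + 4(d+1)(M·Lc^M))` (an2's `cWb d N` one level up). -/
def cWnest (d Lc M : ℕ) : ℝ := (((2 * Lc ^ M + 1) ^ (d + 1) : ℕ) : ℝ) * (((d : ℝ) + 1) * (1 + 4 * ((d : ℝ) + 1) * ((M : ℝ) * (Lc : ℝ) ^ M)))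


/-! ## §0 The two-leg dressings in comp form (an2's `dressKNestAt` ∕ `coDressKNestAt` one level up) -/

section Defs

variable (ρ : Fin (d + 1) → ℤ) (Lc M : ℕ)

/-- [our object, plumbing] **THE NESTED DRESSING OF A (VERTEX-TYPE) KERNEL**: `dressKNestAt`-shape `Π̂_nestᵀ·K·Π̂_nest = comp (comp P K) (trK P)`, `P := piKSymNest ρ Lc M`. -/
def dressKNestAt (K : MKer (d + 1) (Fib d)) : MKer (d + 1) (Fib d) := comp (comp (piKSymNest ρ Lc M) K) (trK (piKSymNest ρ Lc M))

/-- [our object, plumbing] **THE NESTED CO-DRESSING OF A (PROPAGATOR-TYPE) KERNEL**: `coDressKNestAt`-shape `Π̂_nest·K·Π̂_nestᵀ = comp (comp (trK P) K) P` — leaf-02's inline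
`G_nest` pin (`PerfectSecondOrderTablesNested`) by `rfl`. -/
def coDressKNestAt (K : MKer (d + 1) (Fib d)) : MKer (d + 1) (Fib d) := comp (comp (trK (piKSymNest ρ Lc M)) K) (piKSymNest ρ Lc M)

/-- [folklore] `dressKNestAt` unfolds. -/
theorem dressKNestAt_eq (K : MKer (d + 1) (Fib d)) : dressKNestAt ρ Lc M K = comp (comp (piKSymNest ρ Lc M) K) (trK (piKSymNest ρ Lc M)) := rfl

/-- [folklore] `coDressKNestAt` unfolds. -/
theorem coDressKNestAt_eq (K : MKer (d + 1) (Fib d)) : coDressKNestAt ρ Lc M K = comp (comp (trK (piKSymNest ρ Lc M)) K) (piKSymNest ρ Lc M) := rfl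

end Defs

/-! ## §1 The nested window operator `coProjNestAtT` (the `Πᵀ`-side action; FILE 7's `coProjNestAt` is the `Π`-side one) -/

section Window

/-- [folklore] `SymmetrisedDressingMatrix.abs_pmSymNest_le` with the cast `((d+1 : ℕ) : ℝ) = (d : ℝ) + 1` pushed (the comb file's shape). -/
theorem abs_pmSymNest_le' {Lc : ℕ} (hLc : 1 ≤ Lc) {r : Fin (d + 1) → ℕ} (hr : r ∈ box (d + 1) Lc) (M : ℕ) (β : Fin (d + 1)) (p : Fin (d + 1) → ℤ)
    (α : Fin (d + 1)) (q : Fin (d + 1) → ℤ) : |pmSymNest (toSite r) Lc M β p α q| ≤ 1 + 4 * ((d : ℝ) + 1) * ((M : ℝ) * (Lc : ℝ) ^ M) := by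
  have h := abs_pmSymNest_le hLc hr M β p α q
  push_cast at h
  exact h

/-- [folklore] **THE NESTED WINDOW OPERATOR `Π̂ᵀ_nest` ON REAL ONE-FORMS**: `(Π̂ᵀ_nest g)_α(q) = Σ_{v ∈ cube} Σ_β pmSymNest ρ Lc M β (q+v) α q · g_β(q+v)`. -/
def coProjNestAtT (ρ : Fin (d + 1) → ℤ) (Lc M : ℕ) (g : Form1 (d + 1) ℝ) : Form1 (d + 1) ℝ :=
  fun α q => ∑ v ∈ cube (d + 1) (Lc ^ M), ∑ β : Fin (d + 1), pmSymNest ρ Lc M β (q + v) α q * g β (q + v)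

/-- [folklore] Pointwise form of `coProjNestAtT`. -/
theorem coProjNestAtT_apply (ρ : Fin (d + 1) → ℤ) (Lc M : ℕ) (g : Form1 (d + 1) ℝ) (α : Fin (d + 1)) (q : Fin (d + 1) → ℤ) :
    coProjNestAtT ρ Lc M g α q = ∑ v ∈ cube (d + 1) (Lc ^ M), ∑ β : Fin (d + 1), pmSymNest ρ Lc M β (q + v) α q * g β (q + v) := rfl







/-- [folklore] **SUP BOUND FOR `Π̂ᵀ_nest`:** `|(Π̂ᵀ_nest g)_α(q)| ≤ cWb·M` if `|g| ≤ M` on the window bonds at `q` (in-block root). -/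
theorem abs_coProjNestAtT_le {Lc : ℕ} (hLc : 1 ≤ Lc) {r : Fin (d + 1) → ℕ} (hr : r ∈ box (d + 1) Lc) (M : ℕ) (g : Form1 (d + 1) ℝ)
    (α : Fin (d + 1)) (q : Fin (d + 1) → ℤ) {B : ℝ}
    (hM : ∀ (κ : Fin (d + 1)) (v : Fin (d + 1) → ℤ), v ∈ cube (d + 1) (Lc ^ M) → |g κ (q + v)| ≤ B) :
    |coProjNestAtT (toSite r) Lc M g α q| ≤ cWnest d Lc M * B := by
  rw [coProjNestAtT_apply]
  calc |∑ v ∈ cube (d + 1) (Lc ^ M), ∑ β : Fin (d + 1), pmSymNest (toSite r) Lc M β (q + v) α q * g β (q + v)|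
      ≤ ∑ v ∈ cube (d + 1) (Lc ^ M), |∑ β : Fin (d + 1), pmSymNest (toSite r) Lc M β (q + v) α q * g β (q + v)| :=
        Finset.abs_sum_le_sum_abs _ _
    _ ≤ ∑ v ∈ cube (d + 1) (Lc ^ M), ∑ _β : Fin (d + 1), (1 + 4 * ((d : ℝ) + 1) * ((M : ℝ) * (Lc : ℝ) ^ M)) * B :=
        Finset.sum_le_sum fun v hv => (Finset.abs_sum_le_sum_abs _ _).trans
          (Finset.sum_le_sum fun β _ => by
            rw [abs_mul]
            exact mul_le_mul (abs_pmSymNest_le' hLc hr M β (q + v) α q) (hM β v hv) (abs_nonneg _) (by positivity))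
    _ = cWnest d Lc M * B := by
        rw [Finset.sum_const, Finset.sum_const, Finset.card_univ, Fintype.card_fin, card_cube]
        simp only [nsmul_eq_mul]
        unfold cWnest
        push_cast
        ring

/-- [folklore] **`Π̂ᵀ_nest` IS COARSE-TRANSLATION COVARIANT**: `Π̂ᵀ_nest (g ∘ shift (N•z)) (α, q) = (Π̂ᵀ_nest g)(α, q + N•z)`. -/
theorem coProjNestAtT_shift (ρ : Fin (d + 1) → ℤ) {Lc : ℕ} (hLc : 1 ≤ Lc) (M : ℕ) (g : Form1 (d + 1) ℝ) (z : Fin (d + 1) → ℤ)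
    (α : Fin (d + 1)) (q : Fin (d + 1) → ℤ) :
    coProjNestAtT ρ Lc M (fun κ u => g κ (u + ((Lc : ℤ) ^ M) • z)) α q = coProjNestAtT ρ Lc M g α (q + ((Lc : ℤ) ^ M) • z) := by
  rw [coProjNestAtT_apply, coProjNestAtT_apply]
  refine Finset.sum_congr rfl fun v _ => Finset.sum_congr rfl fun β _ => ?_
  rw [add_right_comm q (((Lc : ℤ) ^ M) • z) v, pmSymNest_shift ρ hLc M]

end Window

/-! ## §2 The leg dressings in window form and their identification with the comp form -/

section Legs

/-- [folklore] `Π̂ᵀ_nest` on the FIRST leg of a kernel table (`inl` components; multiplier legs untouched). -/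
def legCo₁NestAt (ρ : Fin (d + 1) → ℤ) (Lc M : ℕ) (K : MKer (d + 1) (Fib d)) : MKer (d + 1) (Fib d) :=
  fun x y a b =>
    match a with
    | Sum.inl α => coProjNestAtT ρ Lc M (fun α' x' => K x' y (Sum.inl α') b) α x
    | Sum.inr _ => K x y a b

/-- [folklore] `Π̂ᵀ_nest` on the SECOND leg of a kernel table. -/
def legCo₂NestAt (ρ : Fin (d + 1) → ℤ) (Lc M : ℕ) (K : MKer (d + 1) (Fib d)) : MKer (d + 1) (Fib d) :=
  fun x y a b =>
    match b with
    | Sum.inl β => coProjNestAtT ρ Lc M (fun β' y' => K x y' a (Sum.inl β')) β y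
    | Sum.inr _ => K x y a b

variable (ρ : Fin (d + 1) → ℤ) (Lc M : ℕ)

/-- [folklore] Computation rule, first leg, field component. -/
theorem legCo₁NestAt_inl (K : MKer (d + 1) (Fib d)) (x y : Fin (d + 1) → ℤ) (α : Fin (d + 1)) (b : Fib d) :
    legCo₁NestAt ρ Lc M K x y (Sum.inl α) b = coProjNestAtT ρ Lc M (fun α' x' => K x' y (Sum.inl α') b) α x := rfl

/-- [folklore] Computation rule, first leg, multiplier component. -/
theorem legCo₁NestAt_inr (K : MKer (d + 1) (Fib d)) (x y : Fin (d + 1) → ℤ) (m : Fin (d + 1)) (b : Fib d) :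
    legCo₁NestAt ρ Lc M K x y (Sum.inr m) b = K x y (Sum.inr m) b := rfl

/-- [folklore] Computation rule, second leg, field component. -/
theorem legCo₂NestAt_inl (K : MKer (d + 1) (Fib d)) (x y : Fin (d + 1) → ℤ) (a : Fib d) (β : Fin (d + 1)) :
    legCo₂NestAt ρ Lc M K x y a (Sum.inl β) = coProjNestAtT ρ Lc M (fun β' y' => K x y' a (Sum.inl β')) β y := rfl

/-- [folklore] Computation rule, second leg, multiplier component. -/
theorem legCo₂NestAt_inr (K : MKer (d + 1) (Fib d)) (x y : Fin (d + 1) → ℤ) (a : Fib d) (m : Fin (d + 1)) :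
    legCo₂NestAt ρ Lc M K x y a (Sum.inr m) = K x y a (Sum.inr m) := rfl

/-- [folklore] Fibre contraction against a ROW of `piKSymNest`, field row: a windowed `pmSymNest`-sum. -/
theorem sum_piKSymNest_mul_inl (x x' : Fin (d + 1) → ℤ) (α : Fin (d + 1)) (g : Fib d → ℝ) :
    ∑ f : Fib d, piKSymNest ρ Lc M x x' (Sum.inl α) f * g f =
      if x' - x ∈ cube (d + 1) (Lc ^ M) then ∑ β : Fin (d + 1), pmSymNest ρ Lc M β x' α x * g (Sum.inl β) else 0 := by
  rw [Fintype.sum_sum_type]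
  simp only [piKSymNest_inl_inl, piKSymNest_inl_inr, zero_mul, Finset.sum_const_zero, add_zero]
  split_ifs
  · rfl
  · simp

/-- [folklore] Fibre contraction against a ROW of `piKSymNest`, multiplier row: the Kronecker delta. -/
theorem sum_piKSymNest_mul_inr (x x' : Fin (d + 1) → ℤ) (m : Fin (d + 1)) (g : Fib d → ℝ) :
    ∑ f : Fib d, piKSymNest ρ Lc M x x' (Sum.inr m) f * g f = if x = x' then g (Sum.inr m) else 0 := by
  rw [Fintype.sum_sum_type]
  simp only [piKSymNest_inr_inl, piKSymNest_inr_inr, zero_mul, Finset.sum_const_zero, zero_add]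
  by_cases h : x = x'
  · simp only [h, true_and, ite_mul, one_mul, zero_mul, Finset.sum_ite_eq, Finset.mem_univ, if_true]
  · simp [h]

/-- [folklore] Fibre contraction against a COLUMN of `piKSymNest` (a row of `trK piKSymNest`), field column. -/
theorem sum_mul_piKSymNest_inl (y y' : Fin (d + 1) → ℤ) (β : Fin (d + 1)) (g : Fib d → ℝ) :
    ∑ f : Fib d, g f * piKSymNest ρ Lc M y y' (Sum.inl β) f =
      if y' - y ∈ cube (d + 1) (Lc ^ M) then ∑ β' : Fin (d + 1), pmSymNest ρ Lc M β' y' β y * g (Sum.inl β') else 0 := by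
  rw [Fintype.sum_sum_type]
  simp only [piKSymNest_inl_inl, piKSymNest_inl_inr, mul_zero, Finset.sum_const_zero, add_zero]
  split_ifs
  · exact Finset.sum_congr rfl fun β' _ => mul_comm _ _
  · simp

/-- [folklore] Fibre contraction against a COLUMN of `piKSymNest`, multiplier column. -/
theorem sum_mul_piKSymNest_inr (y y' : Fin (d + 1) → ℤ) (m : Fin (d + 1)) (g : Fib d → ℝ) :
    ∑ f : Fib d, g f * piKSymNest ρ Lc M y y' (Sum.inr m) f = if y = y' then g (Sum.inr m) else 0 := by
  rw [Fintype.sum_sum_type]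
  simp only [piKSymNest_inr_inl, piKSymNest_inr_inr, mul_zero, Finset.sum_const_zero, zero_add]
  by_cases h : y = y'
  · simp only [h, true_and, mul_ite, mul_one, mul_zero, Finset.sum_ite_eq, Finset.mem_univ, if_true]
  · simp [h]

/-- [folklore] **`Π̂ᵀ_nest` ON THE FIRST LEG IS LEFT COMPOSITION WITH `piKSymNest`**: `legCo₁NestAt ρ Lc M K = comp (piKSymNest ρ Lc M) K`. -/
theorem legCo₁NestAt_eq_comp (K : MKer (d + 1) (Fib d)) : legCo₁NestAt ρ Lc M K = comp (piKSymNest ρ Lc M) K := by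
  funext x y a b
  rcases a with α | m
  · rw [legCo₁NestAt_inl, coProjNestAtT_apply]
    unfold ExpKernelCalculus.comp
    simp_rw [sum_piKSymNest_mul_inl]
    rw [tsum_window]
  · rw [legCo₁NestAt_inr]
    unfold ExpKernelCalculus.comp
    simp_rw [sum_piKSymNest_mul_inr]
    rw [tsum_point]

/-- [folklore] **`Π̂ᵀ_nest` ON THE SECOND LEG IS RIGHT COMPOSITION WITH `trK piKSymNest`**: `legCo₂NestAt ρ Lc M K = comp K (trK (piKSymNest ρ Lc M))`. -/
theorem legCo₂NestAt_eq_comp (K : MKer (d + 1) (Fib d)) : legCo₂NestAt ρ Lc M K = comp K (trK (piKSymNest ρ Lc M)) := by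
  funext x y a b
  rcases b with β | m
  · rw [legCo₂NestAt_inl, coProjNestAtT_apply]
    unfold ExpKernelCalculus.comp
    simp only [trK]
    simp_rw [sum_mul_piKSymNest_inl]
    rw [tsum_window]
  · rw [legCo₂NestAt_inr]
    unfold ExpKernelCalculus.comp
    simp only [trK]
    simp_rw [sum_mul_piKSymNest_inr]
    rw [tsum_point]

/-- [folklore] **THE COMP-FORM DRESSING IS THE TWO LEG DRESSINGS**: `dressKNestAt ρ Lc M K = legCo₂NestAt ρ Lc M (legCo₁NestAt ρ Lc M K)`. -/
theorem dressKNestAt_eq_legs (K : MKer (d + 1) (Fib d)) : dressKNestAt ρ Lc M K = legCo₂NestAt ρ Lc M (legCo₁NestAt ρ Lc M K) := by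
  rw [legCo₂NestAt_eq_comp, legCo₁NestAt_eq_comp]
  rfl

end Legs

/-! ## §3 The dressing through series, scalars, finite sums and weighted superpositions; the chain-rule vertex -/

section LinearBm

variable (ρ : Fin (d + 1) → ℤ) (Lc M : ℕ) (N : ℕ) {ι : Type*}

/-- [folklore] `Π̂ᵀ_nest` passes through pointwise-summable series of one-forms. -/
theorem coProjNestAtT_tsum {g : ι → Form1 (d + 1) ℝ} (hg : ∀ κ p, Summable fun i => g i κ p) (α : Fin (d + 1))
    (q : Fin (d + 1) → ℤ) : coProjNestAtT ρ Lc M (fun κ p => ∑' i, g i κ p) α q = ∑' i, coProjNestAtT ρ Lc M (g i) α q := by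
  simp only [coProjNestAtT_apply]
  rw [Summable.tsum_finsetSum (fun v _ => summable_sum fun β _ => (hg β (q + v)).mul_left _)]
  refine Finset.sum_congr rfl fun v _ => ?_
  rw [Summable.tsum_finsetSum (fun β _ => (hg β (q + v)).mul_left _)]
  refine Finset.sum_congr rfl fun β _ => ?_
  rw [tsum_mul_left]

/-- [folklore] … and the family `i ↦ Π̂ᵀ_nest g_i` is summable at every bond. -/
theorem summable_family_coProjNestAtT {g : ι → Form1 (d + 1) ℝ} (hg : ∀ κ p, Summable fun i => g i κ p) (α : Fin (d + 1))
    (q : Fin (d + 1) → ℤ) : Summable fun i => coProjNestAtT ρ Lc M (g i) α q := by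
  simp only [coProjNestAtT_apply]
  exact summable_sum fun v _ => summable_sum fun β _ => (hg β (q + v)).mul_left _

/-- [folklore] `Π̂ᵀ_nest` on the first leg passes through pointwise-summable series of kernels. -/
theorem legCo₁NestAt_tsum {F : ι → MKer (d + 1) (Fib d)} (hF : ∀ x z a b, Summable fun i => F i x z a b)
    (x z : Fin (d + 1) → ℤ) (a b : Fib d) :
    legCo₁NestAt ρ Lc M (fun x z a b => ∑' i, F i x z a b) x z a b = ∑' i, legCo₁NestAt ρ Lc M (F i) x z a b := by
  rcases a with α | m
  · rw [legCo₁NestAt_inl]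
    exact coProjNestAtT_tsum ρ Lc M (g := fun i α' x' => F i x' z (Sum.inl α') b) (fun κ p => hF p z (Sum.inl κ) b) α x
  · rfl

/-- [folklore] … with a summable family of results. -/
theorem summable_family_legCo₁NestAt {F : ι → MKer (d + 1) (Fib d)} (hF : ∀ x z a b, Summable fun i => F i x z a b)
    (x z : Fin (d + 1) → ℤ) (a b : Fib d) : Summable fun i => legCo₁NestAt ρ Lc M (F i) x z a b := by
  rcases a with α | m
  · exact summable_family_coProjNestAtT ρ Lc M (g := fun i α' x' => F i x' z (Sum.inl α') b) (fun κ p => hF p z (Sum.inl κ) b) α x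
  · exact hF x z (Sum.inr m) b

/-- [folklore] `Π̂ᵀ_nest` on the second leg passes through pointwise-summable series of kernels. -/
theorem legCo₂NestAt_tsum {F : ι → MKer (d + 1) (Fib d)} (hF : ∀ x z a b, Summable fun i => F i x z a b)
    (x z : Fin (d + 1) → ℤ) (a b : Fib d) :
    legCo₂NestAt ρ Lc M (fun x z a b => ∑' i, F i x z a b) x z a b = ∑' i, legCo₂NestAt ρ Lc M (F i) x z a b := by
  rcases b with β | m
  · rw [legCo₂NestAt_inl]
    exact coProjNestAtT_tsum ρ Lc M (g := fun i β' z' => F i x z' a (Sum.inl β')) (fun κ p => hF x p a (Sum.inl κ)) β z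
  · rfl

/-- [folklore] … with a summable family of results. -/
theorem summable_family_legCo₂NestAt {F : ι → MKer (d + 1) (Fib d)} (hF : ∀ x z a b, Summable fun i => F i x z a b)
    (x z : Fin (d + 1) → ℤ) (a b : Fib d) : Summable fun i => legCo₂NestAt ρ Lc M (F i) x z a b := by
  rcases b with β | m
  · exact summable_family_coProjNestAtT ρ Lc M (g := fun i β' z' => F i x z' a (Sum.inl β')) (fun κ p => hF x p a (Sum.inl κ)) β z
  · exact hF x z a (Sum.inr m)

/-- [folklore] **THE NESTED DRESSING PASSES THROUGH POINTWISE-SUMMABLE SERIES OF KERNELS.** -/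
theorem dressKNestAt_tsum {F : ι → MKer (d + 1) (Fib d)} (hF : ∀ x z a b, Summable fun i => F i x z a b)
    (x z : Fin (d + 1) → ℤ) (a b : Fib d) :
    dressKNestAt ρ Lc M (fun x z a b => ∑' i, F i x z a b) x z a b = ∑' i, dressKNestAt ρ Lc M (F i) x z a b := by
  simp only [dressKNestAt_eq_legs]
  have e : legCo₁NestAt ρ Lc M (fun x z a b => ∑' i, F i x z a b) = fun x z a b => ∑' i, legCo₁NestAt ρ Lc M (F i) x z a b :=
    funext fun x => funext fun z => funext fun a => funext fun b => legCo₁NestAt_tsum ρ Lc M hF x z a b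
  rw [e, legCo₂NestAt_tsum ρ Lc M (summable_family_legCo₁NestAt ρ Lc M hF) x z a b]

/-- [folklore] The nested dressing is homogeneous. -/
theorem dressKNestAt_mul_left (c : ℝ) (K : MKer (d + 1) (Fib d)) (x z : Fin (d + 1) → ℤ) (a b : Fib d) :
    dressKNestAt ρ Lc M (fun x z a b => c * K x z a b) x z a b = c * dressKNestAt ρ Lc M K x z a b := by
  have e1 : ∀ (K : MKer (d + 1) (Fib d)) x z a b, legCo₁NestAt ρ Lc M (fun x z a b => c * K x z a b) x z a b =
      c * legCo₁NestAt ρ Lc M K x z a b := by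
    intro K x z a b
    rcases a with α | m
    · simp only [legCo₁NestAt_inl, coProjNestAtT_apply, Finset.mul_sum]
      exact Finset.sum_congr rfl fun v _ => Finset.sum_congr rfl fun β _ => by ring
    · rfl
  have e2 : ∀ (K : MKer (d + 1) (Fib d)) x z a b, legCo₂NestAt ρ Lc M (fun x z a b => c * K x z a b) x z a b =
      c * legCo₂NestAt ρ Lc M K x z a b := by
    intro K x z a b
    rcases b with β | m
    · simp only [legCo₂NestAt_inl, coProjNestAtT_apply, Finset.mul_sum]
      exact Finset.sum_congr rfl fun v _ => Finset.sum_congr rfl fun β _ => by ring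
    · rfl
  simp only [dressKNestAt_eq_legs]
  have e : legCo₁NestAt ρ Lc M (fun x z a b => c * K x z a b) = fun x z a b => c * legCo₁NestAt ρ Lc M K x z a b :=
    funext fun x => funext fun z => funext fun a => funext fun b => e1 K x z a b
  rw [e, e2]

/-- [folklore] The nested dressing is additive over finite sums. -/
theorem dressKNestAt_finset_sum (s : Finset ι) (K : ι → MKer (d + 1) (Fib d)) (x z : Fin (d + 1) → ℤ) (a b : Fib d) :
    dressKNestAt ρ Lc M (fun x z a b => ∑ i ∈ s, K i x z a b) x z a b = ∑ i ∈ s, dressKNestAt ρ Lc M (K i) x z a b := by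
  have e1 : ∀ (K : ι → MKer (d + 1) (Fib d)) x z a b, legCo₁NestAt ρ Lc M (fun x z a b => ∑ i ∈ s, K i x z a b) x z a b =
      ∑ i ∈ s, legCo₁NestAt ρ Lc M (K i) x z a b := by
    intro K x z a b
    rcases a with α | m
    · simp only [legCo₁NestAt_inl, coProjNestAtT_apply, Finset.mul_sum]
      calc ∑ v ∈ cube (d + 1) (Lc ^ M), ∑ β : Fin (d + 1), ∑ i ∈ s, pmSymNest ρ Lc M β (x + v) α x * K i (x + v) z (Sum.inl β) b
          = ∑ v ∈ cube (d + 1) (Lc ^ M), ∑ i ∈ s, ∑ β : Fin (d + 1), pmSymNest ρ Lc M β (x + v) α x * K i (x + v) z (Sum.inl β) b :=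
            Finset.sum_congr rfl fun v _ => Finset.sum_comm
        _ = ∑ i ∈ s, ∑ v ∈ cube (d + 1) (Lc ^ M), ∑ β : Fin (d + 1), pmSymNest ρ Lc M β (x + v) α x * K i (x + v) z (Sum.inl β) b :=
            Finset.sum_comm
    · rfl
  have e2 : ∀ (K : ι → MKer (d + 1) (Fib d)) x z a b, legCo₂NestAt ρ Lc M (fun x z a b => ∑ i ∈ s, K i x z a b) x z a b =
      ∑ i ∈ s, legCo₂NestAt ρ Lc M (K i) x z a b := by
    intro K x z a b
    rcases b with β | m
    · simp only [legCo₂NestAt_inl, coProjNestAtT_apply, Finset.mul_sum]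
      calc ∑ v ∈ cube (d + 1) (Lc ^ M), ∑ β' : Fin (d + 1), ∑ i ∈ s, pmSymNest ρ Lc M β' (z + v) β z * K i x (z + v) a (Sum.inl β')
          = ∑ v ∈ cube (d + 1) (Lc ^ M), ∑ i ∈ s, ∑ β' : Fin (d + 1), pmSymNest ρ Lc M β' (z + v) β z * K i x (z + v) a (Sum.inl β') :=
            Finset.sum_congr rfl fun v _ => Finset.sum_comm
        _ = ∑ i ∈ s, ∑ v ∈ cube (d + 1) (Lc ^ M), ∑ β' : Fin (d + 1), pmSymNest ρ Lc M β' (z + v) β z * K i x (z + v) a (Sum.inl β') :=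
            Finset.sum_comm
    · rfl
  simp only [dressKNestAt_eq_legs]
  have e : legCo₁NestAt ρ Lc M (fun x z a b => ∑ i ∈ s, K i x z a b) = fun x z a b => ∑ i ∈ s, legCo₁NestAt ρ Lc M (K i) x z a b :=
    funext fun x => funext fun z => funext fun a => funext fun b => e1 K x z a b
  rw [e, e2]

/-- [folklore] **THE NESTED DRESSING PASSES THROUGH WEIGHTED SUPERPOSITIONS** (`OneStepResolventKernel.wsum`). -/
theorem dressKNestAt_wsum {w : (Fin (d + 1) → ℤ) → ℝ} {T : (Fin (d + 1) → ℤ) → MKer (d + 1) (Fib d)}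
    (hs : ∀ x z a b, Summable fun u => w u * T u x z a b) :
    dressKNestAt ρ Lc M (wsum w T) = wsum w (fun u => dressKNestAt ρ Lc M (T u)) := by
  funext x z a b
  calc dressKNestAt ρ Lc M (wsum w T) x z a b
      = ∑' u, dressKNestAt ρ Lc M (fun x z a b => w u * T u x z a b) x z a b :=
        dressKNestAt_tsum ρ Lc M (F := fun u x z a b => w u * T u x z a b) hs x z a b
    _ = ∑' u, w u * dressKNestAt ρ Lc M (T u) x z a b := tsum_congr fun u => dressKNestAt_mul_left ρ Lc M (w u) (T u) x z a b
    _ = wsum w (fun u => dressKNestAt ρ Lc M (T u)) x z a b := rfl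

/-- [folklore] **THE CHAIN-RULE VERTEX THROUGH `K` OF NESTED-DRESSED STENCILS IS THE NESTED-DRESSED VERTEX:**
`vertexOfK K N (fun κ u ↦ dressKNestAt ρ Lc M (T κ u)) μ y = dressKNestAt ρ Lc M (vertexOfK K N T μ y)` (decaying `K`, local `T`). -/
theorem vertexOfK_dressKNestAt {K : MKer (d + 1) (Fib d)} {C δ : ℝ} (hK : Decays K C δ) (hδ : 0 ≤ δ)
    {T : Fin (d + 1) → (Fin (d + 1) → ℤ) → MKer (d + 1) (Fib d)} {Ct δt : ℝ} (hT : LocStencil T Ct δt) (hδt : 0 < δt)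
    (μ : Fin (d + 1)) (y : Fin (d + 1) → ℤ) :
    vertexOfK K N (fun κ u => dressKNestAt ρ Lc M (T κ u)) μ y = dressKNestAt ρ Lc M (vertexOfK K N T μ y) := by
  have h : ∀ κ' : Fin (d + 1), wsum (colH K N μ y κ') (fun u => dressKNestAt ρ Lc M (T κ' u)) =
      dressKNestAt ρ Lc M (wsum (colH K N μ y κ') (T κ')) :=
    fun κ' => (dressKNestAt_wsum ρ Lc M (fun x z a b => AxialDressing.summable_colH_mul_stencil hK hδ hT hδt κ' μ y x z a b)).symm
  funext x z a b
  calc vertexOfK K N (fun κ u => dressKNestAt ρ Lc M (T κ u)) μ y x z a b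
      = ∑ κ' : Fin (d + 1), wsum (colH K N μ y κ') (fun u => dressKNestAt ρ Lc M (T κ' u)) x z a b := rfl
    _ = ∑ κ' : Fin (d + 1), dressKNestAt ρ Lc M (wsum (colH K N μ y κ') (T κ')) x z a b :=
        Finset.sum_congr rfl fun κ' _ => by rw [h κ']
    _ = dressKNestAt ρ Lc M (fun x z a b => ∑ κ' : Fin (d + 1), wsum (colH K N μ y κ') (T κ') x z a b) x z a b :=
        (dressKNestAt_finset_sum ρ Lc M Finset.univ (fun κ' => wsum (colH K N μ y κ') (T κ')) x z a b).symm
    _ = dressKNestAt ρ Lc M (vertexOfK K N T μ y) x z a b := rfl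

end LinearBm
end

end Summit.QuantumFields.BalabanUV.Beta.FP.NestedDressingLegs
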